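import Summits.ResolutionOfSingularities.ResolutionOfSingularities.Theorems.PurelyInseparableDim4ResConeSwapCone
import HarnessLib
import HarnessLib.Audit.Tags

/-!
# Purely inseparable four-folds — THE INITIAL FORM, THE RESIDUAL CONE AND `e_G` THROUGH A RE-PRESENTATION WITH AN ARBITRARY
# 1-JET; the SLOT-UNIT class `ℛ²` (cell `res-dim4-pi`, K2(p) lane, slice B, brick «UnitClassOrder» part 2/2, FILE B)

[OURS · counted 0 · cell `res-dim4-pi` · K2(p) lane (holder res-dim4-p-12 g3, scope word 2026-08-29T04:43:23Z «in_o / power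
cone / e_G through ℛ and ℛ², d-generic») · seat res-dim4-p-7 g4 · consumers res-dim4-typ-1 g3 (K24b-R1 virtual window:
«in_o through the relation ⇒ finrank resVertex B = finrank resVertex A», 04:57:08Z) and res-dim4-p-1 g4 (K24a-R1′).]  Nothing
here proves K2(p)/K2(5), `NoIsolatedTrap p p`, or resolution of singularities in dimension ≥ 4 / characteristic `p`.  AI
kernel work, weaker than expert review.

res-dim4-p-1 g4's `…ResConeSwapCone` (`ResCone.initialForm_of_diag_rel`, `resForm_powerCone_of_diag_rel`,
`finrank_resVertex_of_diag_rel`) does this for a DIAGONAL substitution.  Here `θ` is ANY origin-fixing substitution with a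
chosen 1-JET `J` (`J k` homogeneous of degree 1, `θ k − J k ∈ 𝔪₀²`):
* §1 `aeval_sub_aeval_jet_mem`: `θ(P) − J(P) ∈ 𝔪₀^{o+1}` for `P ∈ 𝔪₀^o` (telescoping `∏ θ_k^{n_k} − ∏ J_k^{n_k}`);
  `isHomogeneous_aeval_jet`.
* §2 **`initialForm_of_jet_rel`**: `F_B = clean_p(U^p · θ F_A) + E`, `E ∈ 𝔪₀ᴹ`, `ord₀ F_A = o < M`, `p ∤ o`, and
  `J(in F_A) ≠ 0` ⇒ `ord₀ F_B = o ∧ in F_B = U(0)^p · J(in F_A)` (p-1's proof with §1 in place of the diagonal lemma).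
* §3 the SLOT-UNIT class `ℛ²_π` (res-dim4-typ-1 g3's `unitFrame_step₂` binders: `θ(x_{π i}) = x_i e_i` on the two SLOT
  letters `i ∉ {u, f}`, `θ(x_{πu}), θ(x_{πf})` merely origin-fixing; SN3's one-free-letter class is the case `θ(x_{πu}) =
  x_u e_u`), with the CANONICAL jet `J k := Σ_l coeff_{e_l}(θ k) · x_l`: `aeval_jet_monomial_slots` (the jet is diagonal on a
  boundary monomial supported on the slots), **`resForm_of_slotUnit_rel`** (`resForm B = c · J(resForm A)`, `c ≠ 0`),
  **`resForm_powerCone_of_slotUnit_rel`** (`a·(Σ ℓ_k x_k)^d ↦ a′·(Σ_i ℓ′_i x_i)^d`, `ℓ′ = ℓ ᵥ* (tangent matrix)`, i.e.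
  `ℓ′_i = Σ_k ℓ_k · coeff_{e_i}(θ(x_k))`), **`finrank_resVertex_of_slotUnit_rel`** (`e_G(B) = 3 = e_G(A)` for a power cone,
  `1 ≤ d < p`, given `ℓ′ ≠ 0`), `linearForm_ne_zero`, and `vecMul_ne_zero_of_isUnit` (`ℓ′ ≠ 0` from `ℓ ≠ 0` and an invertible tangent — typ-1's
  `isUnit_det_slotUnitClass₂`).
[cite: Hauser2010, §§F–G (chart expressions; cleaning)] [cite: CossartJannsenSaito2020, Def. 2.18] [folklore]
bears_on: LADDER-RESOLUTION:D157-DOOR2 (res-dim4-pi · K2(p) · slice B · UnitClassOrder B).  Supports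
stmt-ResolutionOfSingularities-16155 (helper).
-/

set_option linter.dupNamespace false -- mandated namespace of this single-conjunct summit

noncomputable section

namespace Summit.ResolutionOfSingularities.ResolutionOfSingularities.Theorems.PIDim4

namespace SwapNorm

open MvPolynomial Finset
open Literature.AlgebraicGeometry.Resolution
open Literature.AlgebraicGeometry.Resolution.CentreBlowup
open Literature.AlgebraicGeometry.Resolution.Hauser2010
open Literature.AlgebraicGeometry.Resolution.HauserPerlega2019
open PointBlowup (additiveSubspace)

variable {K : Type} [Field K]

/-! ## §1 A substitution agrees with its 1-jet to first order -/

/-- A form of degree `1` lies in `𝔪₀`. [folklore] -/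
theorem mem_originIdeal_of_isHomogeneous_one {L : MvPolynomial (Fin 4) K} (hL : L.IsHomogeneous 1) :
    L ∈ originIdeal K := by
  rw [← pow_one (originIdeal K), IsolationCert.mem_originIdeal_pow_iff]
  intro d hd
  exact hL.coeff_eq_zero (ne_of_lt hd)

/-- `a ≡ b (mod 𝔪₀²)` with `b ∈ 𝔪₀` ⇒ `aⁿ ≡ bⁿ (mod 𝔪₀ⁿ⁺¹)`. [folklore] -/
theorem pow_sub_pow_mem_pow_succ {a b : MvPolynomial (Fin 4) K} (hb : b ∈ originIdeal K)
    (hab : a - b ∈ originIdeal K ^ 2) (n : ℕ) : a ^ n - b ^ n ∈ originIdeal K ^ (n + 1) := by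
  have ha : a ∈ originIdeal K := by
    have h : a = b + (a - b) := by ring
    rw [h]
    exact Ideal.add_mem _ hb (Ideal.pow_le_self two_ne_zero hab)
  rcases Nat.eq_zero_or_pos n with rfl | hn
  · rw [pow_zero, pow_zero, sub_self]; exact Ideal.zero_mem _
  · rw [← geom_sum₂_mul, show n + 1 = (n - 1) + 2 by omega, pow_add]
    refine Ideal.mul_mem_mul (Ideal.sum_mem _ fun i hi => ?_) hab
    have hi' := Finset.mem_range.mp hi
    have h := Ideal.mul_mem_mul (Ideal.pow_mem_pow ha i) (Ideal.pow_mem_pow hb (n - 1 - i))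
    rw [← pow_add, show i + (n - 1 - i) = n - 1 by omega] at h
    exact h

/-- Telescoping over the four letters: `∏ θ_k^{n_k} − ∏ J_k^{n_k} ∈ 𝔪₀^{|n|+1}`. [folklore] -/
theorem prod_pow_sub_prod_pow_mem {θ J : Fin 4 → MvPolynomial (Fin 4) K} (hJ : ∀ k, J k ∈ originIdeal K)
    (hθJ : ∀ k, θ k - J k ∈ originIdeal K ^ 2) (n : Fin 4 →₀ ℕ) :
    (∏ k, θ k ^ n k) - ∏ k, J k ^ n k ∈ originIdeal K ^ (n.degree + 1) := by
  have hθ : ∀ k, θ k ∈ originIdeal K := fun k => by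
    have h : θ k = J k + (θ k - J k) := by ring
    rw [h]
    exact Ideal.add_mem _ (hJ k) (Ideal.pow_le_self two_ne_zero (hθJ k))
  have hd : ∀ k, θ k ^ n k - J k ^ n k ∈ originIdeal K ^ (n k + 1) := fun k =>
    pow_sub_pow_mem_pow_succ (hJ k) (hθJ k) (n k)
  have ha : ∀ k, θ k ^ n k ∈ originIdeal K ^ n k := fun k => Ideal.pow_mem_pow (hθ k) _
  have hb : ∀ k, J k ^ n k ∈ originIdeal K ^ n k := fun k => Ideal.pow_mem_pow (hJ k) _
  rw [Fin.prod_univ_four, Fin.prod_univ_four, Finsupp.degree_eq_sum, Fin.sum_univ_four]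
  have hsplit : θ 0 ^ n 0 * θ 1 ^ n 1 * θ 2 ^ n 2 * θ 3 ^ n 3 - J 0 ^ n 0 * J 1 ^ n 1 * J 2 ^ n 2 * J 3 ^ n 3 =
      (θ 0 ^ n 0 - J 0 ^ n 0) * θ 1 ^ n 1 * θ 2 ^ n 2 * θ 3 ^ n 3 +
      J 0 ^ n 0 * (θ 1 ^ n 1 - J 1 ^ n 1) * θ 2 ^ n 2 * θ 3 ^ n 3 +
      J 0 ^ n 0 * J 1 ^ n 1 * (θ 2 ^ n 2 - J 2 ^ n 2) * θ 3 ^ n 3 +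
      J 0 ^ n 0 * J 1 ^ n 1 * J 2 ^ n 2 * (θ 3 ^ n 3 - J 3 ^ n 3) := by ring
  rw [hsplit]
  refine Ideal.add_mem _ (Ideal.add_mem _ (Ideal.add_mem _ ?_ ?_) ?_) ?_
  · rw [show n 0 + n 1 + n 2 + n 3 + 1 = (n 0 + 1) + n 1 + n 2 + n 3 by ring, pow_add, pow_add, pow_add]
    exact Ideal.mul_mem_mul (Ideal.mul_mem_mul (Ideal.mul_mem_mul (hd 0) (ha 1)) (ha 2)) (ha 3)
  · rw [show n 0 + n 1 + n 2 + n 3 + 1 = n 0 + (n 1 + 1) + n 2 + n 3 by ring, pow_add, pow_add, pow_add]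
    exact Ideal.mul_mem_mul (Ideal.mul_mem_mul (Ideal.mul_mem_mul (hb 0) (hd 1)) (ha 2)) (ha 3)
  · rw [show n 0 + n 1 + n 2 + n 3 + 1 = n 0 + n 1 + (n 2 + 1) + n 3 by ring, pow_add, pow_add, pow_add]
    exact Ideal.mul_mem_mul (Ideal.mul_mem_mul (Ideal.mul_mem_mul (hb 0) (hb 1)) (hd 2)) (ha 3)
  · rw [show n 0 + n 1 + n 2 + n 3 + 1 = n 0 + n 1 + n 2 + (n 3 + 1) by ring, pow_add, pow_add, pow_add]
    exact Ideal.mul_mem_mul (Ideal.mul_mem_mul (Ideal.mul_mem_mul (hb 0) (hb 1)) (hb 2)) (hd 3)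

/-- **A substitution agrees with its 1-jet to first order**: `J k` homogeneous of degree `1`, `θ k − J k ∈ 𝔪₀²` for all
`k`, and every monomial of `P` of degree `≥ o` ⇒ `θ(P) − J(P) ∈ 𝔪₀^{o+1}`. [folklore] -/
theorem aeval_sub_aeval_jet_mem {θ J : Fin 4 → MvPolynomial (Fin 4) K} (hJ1 : ∀ k, (J k).IsHomogeneous 1)
    (hθJ : ∀ k, θ k - J k ∈ originIdeal K ^ 2) {P : MvPolynomial (Fin 4) K} {o : ℕ}
    (hP : ∀ n ∈ P.support, o ≤ n.degree) : aeval θ P - aeval J P ∈ originIdeal K ^ (o + 1) := by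
  classical
  have hJ : ∀ k, J k ∈ originIdeal K := fun k => mem_originIdeal_of_isHomogeneous_one (hJ1 k)
  rw [show aeval θ P - aeval J P = ∑ n ∈ P.support, (aeval θ (monomial n (coeff n P)) - aeval J (monomial n (coeff n P))) by
    conv_lhs => rw [P.as_sum]
    rw [map_sum, map_sum, ← Finset.sum_sub_distrib]]
  refine Ideal.sum_mem _ fun n hn => ?_
  have h : aeval θ (monomial n (coeff n P)) - aeval J (monomial n (coeff n P)) ∈ originIdeal K ^ (n.degree + 1) := by
    rw [aeval_monomial, aeval_monomial, algebraMap_eq, Finsupp.prod_pow, Finsupp.prod_pow, ← mul_sub]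
    exact Ideal.mul_mem_left _ _ (prod_pow_sub_prod_pow_mem hJ hθJ n)
  exact Ideal.pow_le_pow_right (by have := hP n hn; omega) h

/-- A substitution by forms of degree `1` keeps homogeneity and degree. [folklore] -/
theorem isHomogeneous_aeval_jet {J : Fin 4 → MvPolynomial (Fin 4) K} (hJ1 : ∀ k, (J k).IsHomogeneous 1)
    {P : MvPolynomial (Fin 4) K} {o : ℕ} (hP : P.IsHomogeneous o) : (aeval J P).IsHomogeneous o := by
  have h := hP.eval₂ (algebraMap K (MvPolynomial (Fin 4) K)) J (fun r => isHomogeneous_C _ r) hJ1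
  rw [one_mul] at h
  exact h

/-! ## §2 The initial form through a re-presentation with an arbitrary 1-jet -/

section Rel

variable (p : ℕ)

/-- **THE INITIAL FORM THROUGH A RE-PRESENTATION, ARBITRARY 1-JET**: `F_B = clean_p(U^p · θ F_A) + E` with `θ` agreeing
with `J` (forms of degree `1`) modulo `𝔪₀²`, `U(0) ≠ 0`, `E ∈ 𝔪₀ᴹ`, `ord₀ F_A = o`, `p ∤ o`, `o < M`, and `J(in F_A) ≠ 0`:
then `ord₀ F_B = o` and `in(F_B) = U(0)^p · J(in F_A)` (res-dim4-p-1 g4's `ResCone.initialForm_of_diag_rel` is the diagonal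
case, where `J(in F_A) ≠ 0` is automatic). [OURS] [cite: Hauser2010, §§F–G] -/
theorem initialForm_of_jet_rel {θ J : Fin 4 → MvPolynomial (Fin 4) K} (hJ1 : ∀ k, (J k).IsHomogeneous 1)
    (hθJ : ∀ k, θ k - J k ∈ originIdeal K ^ 2) {U E F_A F_B : MvPolynomial (Fin 4) K} (hU : constantCoeff U ≠ 0)
    {M o : ℕ} (hE : E ∈ originIdeal K ^ M) (hrel : F_B = deletePthPowers p (U ^ p * aeval θ F_A) + E)
    (ho : ordZero F_A = o) (hpo : ¬ p ∣ o) (hoM : o < M) (hJ0 : aeval J (initialForm F_A) ≠ 0) :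
    ordZero F_B = o ∧ initialForm F_B = C (constantCoeff U ^ p) * aeval J (initialForm F_A) := by
  classical
  have hJ : ∀ k, J k ∈ originIdeal K := fun k => mem_originIdeal_of_isHomogeneous_one (hJ1 k)
  have hθ0 : ∀ k, constantCoeff (θ k) = 0 := fun k => by
    have h : θ k = J k + (θ k - J k) := by ring
    have hm : θ k ∈ originIdeal K := by rw [h]; exact Ideal.add_mem _ (hJ k) (Ideal.pow_le_self two_ne_zero (hθJ k))
    have := (IsolationCert.mem_originIdeal_pow_iff 1 (θ k)).mp (by rwa [pow_one]) 0 (by simp)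
    rwa [← constantCoeff_eq] at this
  -- `F_A = in F_A + R`, `R ∈ 𝔪₀^{o+1}`
  have hinH : (initialForm F_A).IsHomogeneous o := Directrix.initialForm_isHomogeneous ho
  have hsupp : ∀ n ∈ F_A.support, o ≤ n.degree := fun n hn => by
    have h := Literature.Barriers.ResolutionOfSingularities.ordZero_le_of_coeff_ne_zero _ _
      (MvPolynomial.mem_support_iff.mp hn)
    rw [ho] at h
    exact_mod_cast h
  have hR : F_A - initialForm F_A ∈ originIdeal K ^ (o + 1) := by
    rw [IsolationCert.mem_originIdeal_pow_iff]
    intro d hd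
    rw [coeff_sub, Directrix.initialForm_eq_homogeneousComponent ho, coeff_homogeneousComponent]
    split_ifs with hdo
    · exact sub_self _
    · by_cases hmem : d ∈ F_A.support
      · exact absurd (le_antisymm (by have := hsupp d hmem; omega) (hsupp d hmem)) hdo
      · rw [MvPolynomial.notMem_support_iff.mp hmem, sub_zero]
  -- the homogeneous part `H = U(0)^p · J(in F_A)`
  set H := C (constantCoeff U ^ p) * aeval J (initialForm F_A) with hH
  have hHhom : H.IsHomogeneous o := by
    have h1 := (isHomogeneous_C (Fin 4) (constantCoeff U ^ p)).mul (isHomogeneous_aeval_jet hJ1 hinH)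
    rwa [zero_add] at h1
  have hH0 : H ≠ 0 := by
    rw [hH]
    exact mul_ne_zero (by rw [Ne, C_eq_zero]; exact pow_ne_zero _ hU) hJ0
  -- `U^p · θ(F_A) = H + (𝔪₀^{o+1})`
  have hθFA : aeval θ F_A - aeval J (initialForm F_A) ∈ originIdeal K ^ (o + 1) := by
    have h1 : aeval θ F_A - aeval θ (initialForm F_A) ∈ originIdeal K ^ (o + 1) := by
      rw [← map_sub]; exact aeval_mem_pow hθ0 hR
    have h2 := aeval_sub_aeval_jet_mem hJ1 hθJ (P := initialForm F_A) (o := o) (fun n hn =>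
      le_of_eq (by have := hinH (MvPolynomial.mem_support_iff.mp hn); rw [ResCone.weight_one_eq_degree] at this;
                   exact this.symm))
    have := Ideal.add_mem _ h1 h2
    rwa [sub_add_sub_cancel] at this
  have hθo : aeval θ F_A ∈ originIdeal K ^ o := by
    have h1 : aeval J (initialForm F_A) ∈ originIdeal K ^ o := by
      rw [IsolationCert.mem_originIdeal_pow_iff]
      intro d hd
      exact (isHomogeneous_aeval_jet hJ1 hinH).coeff_eq_zero (ne_of_lt hd)
    have := Ideal.add_mem _ (Ideal.pow_le_pow_right (Nat.le_succ o) hθFA) h1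
    rwa [sub_add_cancel] at this
  have hUp : U ^ p * aeval θ F_A - H ∈ originIdeal K ^ (o + 1) := by
    have hsplit : U ^ p * aeval θ F_A - H =
        (U ^ p - C (constantCoeff U ^ p)) * aeval θ F_A + C (constantCoeff U ^ p) * (aeval θ F_A - aeval J (initialForm F_A)) := by
      rw [hH]; ring
    rw [hsplit]
    refine Ideal.add_mem _ ?_ (Ideal.mul_mem_left _ _ hθFA)
    rw [pow_succ']
    exact Ideal.mul_mem_mul (ResCone.pow_sub_C_pow_mem U p) hθo
  -- cleaning and the error keep `H + (𝔪₀^{o+1})`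
  have hclean : deletePthPowers p (U ^ p * aeval θ F_A) - H ∈ originIdeal K ^ (o + 1) := by
    have h1 : deletePthPowers p (U ^ p * aeval θ F_A) = H + deletePthPowers p (U ^ p * aeval θ F_A - H) := by
      conv_lhs => rw [show U ^ p * aeval θ F_A = H + (U ^ p * aeval θ F_A - H) by ring]
      rw [deletePthPowers_add, ResCone.deletePthPowers_of_isHomogeneous p hHhom hpo]
    rw [h1, add_sub_cancel_left]
    exact deletePthPowers_mem_pow p hUp
  have hFB : F_B = H + (deletePthPowers p (U ^ p * aeval θ F_A) - H + E) := by rw [hrel]; ring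
  have hrest : deletePthPowers p (U ^ p * aeval θ F_A) - H + E ∈ originIdeal K ^ (o + 1) :=
    Ideal.add_mem _ hclean (Ideal.pow_le_pow_right (by omega) hE)
  rw [hFB]
  exact ResCone.ordZero_initialForm_of_add_mem hHhom hH0 hrest

end Rel

/-! ## §3 The slot-unit class `ℛ²`: residual cone, power cone, `e_G` -/

section SlotUnit

variable (p : ℕ)
variable {π : Equiv.Perm (Fin 4)} {u f : Fin 4} {θ e : Fin 4 → MvPolynomial (Fin 4) K}

/-- The canonical jet of a polynomial: `Σ_l coeff_{e_l}(P) · x_l` is a form of degree `1`. [folklore] -/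
theorem isHomogeneous_linearForm (c : Fin 4 → K) : (∑ l, C (c l) * X l : MvPolynomial (Fin 4) K).IsHomogeneous 1 := by
  refine IsHomogeneous.sum _ _ _ fun l _ => ?_
  have h := (isHomogeneous_C (Fin 4) (c l)).mul (isHomogeneous_X K l)
  rwa [zero_add] at h

/-- The canonical jet of `x_i · e` is `e(0) · x_i`. [folklore] -/
theorem linearForm_X_mul (i : Fin 4) (E : MvPolynomial (Fin 4) K) :
    (∑ l, C (coeff (Finsupp.single l 1) (X i * E)) * X l : MvPolynomial (Fin 4) K) = C (constantCoeff E) * X i := by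
  classical
  rw [Finset.sum_eq_single i]
  · rw [coeff_X_mul', if_pos (by simp), tsub_self, ← constantCoeff_eq]
  · intro l _ hli
    rw [coeff_single_X_mul hli.symm, C_0, zero_mul]
  · intro h; exact absurd (mem_univ i) h

/-- **The jet on a boundary monomial supported on the slots**: for `θ(x_{π i}) = x_i e_i` (`i ∉ {u, f}`) and
`r (π u) = r (π f) = 0`, `J(x^r) = (∏_{i ∉ {u,f}} e_i(0)^{r(π i)}) · x^{r♯}`. [folklore] -/
theorem aeval_jet_monomial_slots (hθi : ∀ i, i ≠ u → i ≠ f → θ (π i) = X i * e i) {r : Fin 4 →₀ ℕ}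
    (hru : r (π u) = 0) (hrf : r (π f) = 0) (c : K) :
    aeval (fun k => ∑ l, C (coeff (Finsupp.single l 1) (θ k)) * X l) (monomial r c) =
      C (c * ∏ i, constantCoeff (e i) ^ r (π i)) * monomial (Finsupp.mapDomain π.symm r) 1 := by
  classical
  rw [aeval_monomial, algebraMap_eq, Finsupp.prod_pow, ← Equiv.prod_comp π]
  have hfac : ∀ i, (∑ l, C (coeff (Finsupp.single l 1) (θ (π i))) * X l) ^ r (π i) =
      C (constantCoeff (e i) ^ r (π i)) * X i ^ r (π i) := by
    intro i
    by_cases hiu : i = u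
    · subst hiu; rw [hru, pow_zero, pow_zero, pow_zero, C_1, one_mul]
    by_cases hif : i = f
    · subst hif; rw [hrf, pow_zero, pow_zero, pow_zero, C_1, one_mul]
    rw [hθi i hiu hif, linearForm_X_mul, mul_pow, ← map_pow]
  simp only [hfac]
  rw [prod_mul_distrib, ← map_prod, map_mul, mul_assoc]
  congr 1
  rw [monomial_eq, C_1, one_mul, Finsupp.prod_pow]
  simp_rw [ResCone.mapDomain_symm_apply]

/-- **THE RESIDUAL CONE THROUGH THE SLOT-UNIT CLASS**: with the data of `initialForm_of_jet_rel` for the canonical jet of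
`θ`, `θ(x_{π i}) = x_i e_i` (`e_i(0) ≠ 0`) on the slots `i ∉ {u, f}`, boundary `x^{A.r} ∣ A.F` supported on the slots and
`B.r = A.r♯`: `resForm B = c · J(resForm A)` with `c ≠ 0`. [OURS] [cite: CossartJannsenSaito2020, Def. 2.8] -/
theorem resForm_of_slotUnit_rel (hθi : ∀ i, i ≠ u → i ≠ f → θ (π i) = X i * e i)
    (he : ∀ i, i ≠ u → i ≠ f → constantCoeff (e i) ≠ 0) (hθ0 : ∀ k, constantCoeff (θ k) = 0)
    {U E : MvPolynomial (Fin 4) K} {A B : State K} (hU : constantCoeff U ≠ 0) {M o : ℕ} (hE : E ∈ originIdeal K ^ M)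
    (hrel : B.F = deletePthPowers p (U ^ p * aeval θ A.F) + E) (ho : ordZero A.F = o) (hpo : ¬ p ∣ o) (hoM : o < M)
    (hJ0 : aeval (fun k => ∑ l, C (coeff (Finsupp.single l 1) (θ k)) * X l) (initialForm A.F) ≠ 0)
    (hrA : ∀ d ∈ A.F.support, A.r ≤ d) (hru : A.r (π u) = 0) (hrf : A.r (π f) = 0)
    (hrB : B.r = A.r.mapDomain π.symm) :
    ∃ c : K, c ≠ 0 ∧
      ResCone.resForm B = C c * aeval (fun k => ∑ l, C (coeff (Finsupp.single l 1) (θ k)) * X l) (ResCone.resForm A) := by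
  classical
  set J : Fin 4 → MvPolynomial (Fin 4) K := fun k => ∑ l, C (coeff (Finsupp.single l 1) (θ k)) * X l with hJ
  have hJ1 : ∀ k, (J k).IsHomogeneous 1 := fun k => isHomogeneous_linearForm _
  have hθJ : ∀ k, θ k - J k ∈ originIdeal K ^ 2 := fun k => sub_linearForm_mem_sq (hθ0 k)
  obtain ⟨-, hin⟩ := initialForm_of_jet_rel p hJ1 hθJ hU hE hrel ho hpo hoM hJ0
  have hE0 : ∏ i, constantCoeff (e i) ^ A.r (π i) ≠ 0 := by
    refine prod_ne_zero_iff.mpr fun i _ => ?_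
    by_cases hiu : i = u
    · subst hiu; rw [hru, pow_zero]; exact one_ne_zero
    by_cases hif : i = f
    · subst hif; rw [hrf, pow_zero]; exact one_ne_zero
    exact pow_ne_zero _ (he i hiu hif)
  refine ⟨constantCoeff U ^ p * ∏ i, constantCoeff (e i) ^ A.r (π i), mul_ne_zero (pow_ne_zero _ hU) hE0, ?_⟩
  set c : K := constantCoeff U ^ p * ∏ i, constantCoeff (e i) ^ A.r (π i) with hc
  unfold ResCone.resForm
  rw [hin, ← ResCone.monomial_mul_resForm hrA, map_mul, aeval_jet_monomial_slots hθi hru hrf, one_mul, hrB, ← mul_assoc,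
    ← mul_assoc, ← map_mul, ← hc, show C c * (monomial (Finsupp.mapDomain (⇑(Equiv.symm π)) A.r) (1 : K)) =
      monomial (Finsupp.mapDomain (⇑(Equiv.symm π)) A.r) (1 : K) * C c by rw [mul_comm],
    mul_assoc, divMonomial_monomial_mul, divMonomial_monomial_mul]

/-- The canonical jet on a linear form: `J(Σ_k ℓ_k x_k) = Σ_i ℓ′_i x_i` with `ℓ′_i = Σ_k ℓ_k · coeff_{e_i}(θ(x_k))`, i.e.
`ℓ′ = ℓ ᵥ* (tangent matrix)`. [folklore] -/
theorem aeval_jet_linearForm (θ : Fin 4 → MvPolynomial (Fin 4) K) (ℓ : Fin 4 → K) :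
    aeval (fun k => ∑ l, C (coeff (Finsupp.single l 1) (θ k)) * X l) (∑ k, C (ℓ k) * X k) =
      ∑ i, C (∑ k, ℓ k * coeff (Finsupp.single i 1) (θ k)) * X i := by
  rw [map_sum]
  simp only [map_mul, aeval_C, aeval_X, algebraMap_eq, mul_sum]
  rw [Finset.sum_comm]
  refine Finset.sum_congr rfl fun i _ => ?_
  rw [map_sum, sum_mul]
  refine Finset.sum_congr rfl fun k _ => ?_
  rw [map_mul]; ring

/-- The coefficients of a linear form. [folklore] -/
theorem coeff_single_linearForm (ℓ : Fin 4 → K) (i : Fin 4) :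
    coeff (Finsupp.single i 1) (∑ k, C (ℓ k) * X k : MvPolynomial (Fin 4) K) = ℓ i := by
  classical
  rw [coeff_sum, Finset.sum_eq_single i]
  · rw [coeff_C_mul, coeff_X, if_pos rfl, mul_one]
  · intro k _ hki
    rw [coeff_C_mul, ← pow_one (X k : MvPolynomial (Fin 4) K), coeff_X_pow,
      if_neg (fun h => hki (Finsupp.single_left_injective one_ne_zero h)), mul_zero]
  · intro h; exact absurd (mem_univ i) h

/-- A non-zero coefficient vector gives a non-zero linear form. [folklore] -/
theorem linearForm_ne_zero {ℓ : Fin 4 → K} (hℓ : ℓ ≠ 0) : (∑ k, C (ℓ k) * X k : MvPolynomial (Fin 4) K) ≠ 0 := by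
  obtain ⟨i, hi⟩ := Function.ne_iff.mp hℓ
  intro h0
  have h := coeff_single_linearForm ℓ i
  rw [h0, coeff_zero] at h
  exact hi h.symm

/-- **A POWER CONE THROUGH THE SLOT-UNIT CLASS**: if `x^{A.r} ∣ A.F` with `A.r` supported on the slots, `ord₀ A.F = o`,
`p ∤ o`, `o < M`, and `resForm A = a·(Σ ℓ_k x_k)^d` (`a ≠ 0`), then for the transported form `ℓ′_i = Σ_k ℓ_k ·
coeff_{e_i}(θ(x_k))` — assumed non-zero (invertible tangent) — `resForm B = a′·(Σ ℓ′_i x_i)^d` with `a′ ≠ 0`. [OURS]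
[cite: CossartJannsenSaito2020, Def. 2.8] -/
theorem resForm_powerCone_of_slotUnit_rel (hθi : ∀ i, i ≠ u → i ≠ f → θ (π i) = X i * e i)
    (he : ∀ i, i ≠ u → i ≠ f → constantCoeff (e i) ≠ 0) (hθ0 : ∀ k, constantCoeff (θ k) = 0)
    {U E : MvPolynomial (Fin 4) K} {A B : State K} (hU : constantCoeff U ≠ 0) {M o : ℕ} (hE : E ∈ originIdeal K ^ M)
    (hrel : B.F = deletePthPowers p (U ^ p * aeval θ A.F) + E) (ho : ordZero A.F = o) (hpo : ¬ p ∣ o) (hoM : o < M)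
    (hrA : ∀ d ∈ A.F.support, A.r ≤ d) (hru : A.r (π u) = 0) (hrf : A.r (π f) = 0)
    (hrB : B.r = A.r.mapDomain π.symm) {a : K} {ℓ : Fin 4 → K} {d : ℕ}
    (hform : ResCone.resForm A = C a * (∑ k, C (ℓ k) * X k) ^ d) (ha : a ≠ 0)
    (hℓ' : (fun i => ∑ k, ℓ k * coeff (Finsupp.single i 1) (θ k)) ≠ 0) :
    ∃ a' : K, a' ≠ 0 ∧
      ResCone.resForm B = C a' * (∑ i, C (∑ k, ℓ k * coeff (Finsupp.single i 1) (θ k)) * X i) ^ d := by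
  classical
  have hJ0 : aeval (fun k => ∑ l, C (coeff (Finsupp.single l 1) (θ k)) * X l) (initialForm A.F) ≠ 0 := by
    have hE0 : ∏ i, constantCoeff (e i) ^ A.r (π i) ≠ 0 := by
      refine prod_ne_zero_iff.mpr fun i _ => ?_
      by_cases hiu : i = u
      · subst hiu; rw [hru, pow_zero]; exact one_ne_zero
      by_cases hif : i = f
      · subst hif; rw [hrf, pow_zero]; exact one_ne_zero
      exact pow_ne_zero _ (he i hiu hif)
    rw [← ResCone.monomial_mul_resForm hrA, hform, map_mul, map_mul, map_pow, aeval_jet_monomial_slots hθi hru hrf,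
      aeval_C, algebraMap_eq, aeval_jet_linearForm, one_mul]
    exact mul_ne_zero (mul_ne_zero (by rw [Ne, C_eq_zero]; exact hE0) (by rw [Ne, monomial_eq_zero]; exact one_ne_zero))
      (mul_ne_zero (by rw [Ne, C_eq_zero]; exact ha) (pow_ne_zero _ (linearForm_ne_zero hℓ')))
  obtain ⟨c, hc, hres⟩ := resForm_of_slotUnit_rel p hθi he hθ0 hU hE hrel ho hpo hoM hJ0 hrA hru hrf hrB
  refine ⟨c * a, mul_ne_zero hc ha, ?_⟩
  rw [hres, hform, map_mul, map_pow, aeval_C, algebraMap_eq, aeval_jet_linearForm, map_mul, mul_assoc]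

/-- **`e_G` THROUGH THE SLOT-UNIT CLASS (POWER CONES)**: with the data of `resForm_powerCone_of_slotUnit_rel` and
`1 ≤ d < p`, both states have `e_G = finrank resVertex = 3`; in particular `finrank resVertex B = finrank resVertex A`.
[OURS] [cite: CossartJannsenSaito2020, Def. 2.18] -/
theorem finrank_resVertex_of_slotUnit_rel [Fact p.Prime] [CharP K p] (hθi : ∀ i, i ≠ u → i ≠ f → θ (π i) = X i * e i)
    (he : ∀ i, i ≠ u → i ≠ f → constantCoeff (e i) ≠ 0) (hθ0 : ∀ k, constantCoeff (θ k) = 0)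
    {U E : MvPolynomial (Fin 4) K} {A B : State K} (hU : constantCoeff U ≠ 0) {M o : ℕ} (hE : E ∈ originIdeal K ^ M)
    (hrel : B.F = deletePthPowers p (U ^ p * aeval θ A.F) + E) (ho : ordZero A.F = o) (hpo : ¬ p ∣ o) (hoM : o < M)
    (hrA : ∀ d ∈ A.F.support, A.r ≤ d) (hru : A.r (π u) = 0) (hrf : A.r (π f) = 0)
    (hrB : B.r = A.r.mapDomain π.symm) {a : K} {ℓ : Fin 4 → K} {d : ℕ}
    (hform : ResCone.resForm A = C a * (∑ k, C (ℓ k) * X k) ^ d) (ha : a ≠ 0) (hℓ : ℓ ≠ 0)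
    (hℓ' : (fun i => ∑ k, ℓ k * coeff (Finsupp.single i 1) (θ k)) ≠ 0) (hd1 : 1 ≤ d) (hdp : d < p) :
    Module.finrank K (ResCone.resVertex B) = 3 ∧
      Module.finrank K (ResCone.resVertex B) = Module.finrank K (ResCone.resVertex A) := by
  obtain ⟨a', ha', hres⟩ :=
    resForm_powerCone_of_slotUnit_rel p hθi he hθ0 hU hE hrel ho hpo hoM hrA hru hrf hrB hform ha hℓ'
  have hB : Module.finrank K (ResCone.resVertex B) = 3 := by
    unfold ResCone.resVertex; rw [hres]; exact ResCone.finrank_additiveSubspace_powerCone p ha' hℓ' hd1 hdp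
  have hA : Module.finrank K (ResCone.resVertex A) = 3 := by
    unfold ResCone.resVertex; rw [hform]; exact ResCone.finrank_additiveSubspace_powerCone p ha hℓ hd1 hdp
  exact ⟨hB, by rw [hB, hA]⟩

/-- **The transported form is non-zero when the tangent is invertible**: `ℓ′ = ℓ ᵥ* N` with
`N k i = coeff_{e_i}(θ(x_k))` (res-dim4-typ-1 g3's tangent matrix, `isUnit_det_slotUnitClass₂`); `IsUnit N.det` and
`ℓ ≠ 0` give `ℓ′ ≠ 0`. [folklore] -/
theorem vecMul_ne_zero_of_isUnit (θ : Fin 4 → MvPolynomial (Fin 4) K) {ℓ : Fin 4 → K} (hℓ : ℓ ≠ 0)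
    (hdet : IsUnit (Matrix.det (Matrix.of fun k i => coeff (Finsupp.single i 1) (θ k)))) :
    (fun i => ∑ k, ℓ k * coeff (Finsupp.single i 1) (θ k)) ≠ 0 := by
  set N : Matrix (Fin 4) (Fin 4) K := Matrix.of fun k i => coeff (Finsupp.single i 1) (θ k) with hN
  have hvec : (fun i => ∑ k, ℓ k * coeff (Finsupp.single i 1) (θ k)) = Matrix.vecMul ℓ N := by
    funext i; rw [Matrix.vecMul, dotProduct]; rfl
  rw [hvec]
  intro h0
  have hinj : Function.Injective N.vecMul :=
    Matrix.vecMul_injective_iff_isUnit.mpr ((Matrix.isUnit_iff_isUnit_det N).mpr hdet)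
  exact hℓ (hinj (show Matrix.vecMul ℓ N = Matrix.vecMul 0 N by rw [h0, Matrix.zero_vecMul]))

end SlotUnit

end SwapNorm

end Summit.ResolutionOfSingularities.ResolutionOfSingularities.Theorems.PIDim4

end
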